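import Summits.KontsevichZagierPeriods.KontsevichZagierPeriods.Theorems.ValuedFieldSpecialisationClassLevelExpansionFibreDimOneFibreSubst
import Summits.KontsevichZagierPeriods.KontsevichZagierPeriods.Theorems.ValuedFieldSpecialisationParametricLiftingFrullaniDilation

/-!
# Route ValuedFieldSpecialisation — crux `ParametricLifting`: the fibred blow-up of the Frullani sector

Stub `frullani_blowup` of the Frullani calibration of the crux `ParametricLifting`
(stmt-KontsevichZagierPeriods-3498), line `registered` (lead c6). Over the base
`G = {0 < s, 2 s < 1}` (`s = z 0`), fibre variable `t = z 1`, the family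
`K = ({s ≤ t ≤ 2 s}, 1/(t (1 + t)))` carries the ESCAPING MASS of the Frullani regularisation: its
slice values tend to `log 2` while its special fibre at `s = 0` is empty. The fibrewise BLOW-UP
`t = s v` (it fixes the parameter `s`, has Jacobian `∂(s v)/∂v = s > 0`, and is strictly increasing
in `v` on every fibre) carries the CONSTANT band `{1 ≤ v ≤ 2}` over `G` onto the band
`{s ≤ t ≤ 2 s}`; pulling `K` back along it (`exists_fibreSubst_pullback`: fibrewise substitutions
along the last coordinate are fibred changes of variables, the pulled-back integrand being
`K.integrand (s, s v) · s`, integrable by the change-of-variables formula) produces a family `D` on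
`{1 ≤ v ≤ 2}` with integrand `1/((s v)(1 + s v)) · s = 1/(v (1 + s v))` and
`[D] − [K] ∈ KZ.fibredRelations`. The family `D` is dominated (special fibre `([1, 2], 1/v)`),
which is recorded elsewhere.

Sources: M. Kontsevich, D. Zagier, *Periods* (2001), §1.2, rule (2); G. Boros, V. Moll,
*Irresistible Integrals* (2004), §5.6 (Frullani). No new definitions.
-/

noncomputable section

namespace Summit.KontsevichZagierPeriods.ValuedFieldSpecialisation

open MeasureTheory Set Filter
open scoped Topology
open Literature.NumberTheory.Transcendental Literature.NumberTheory.Transcendental.KZ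
open Literature.ModelTheory.ExponentialFields (IsSemialgebraic isSemialgebraic_setOf_eval_pos
  isSemialgebraic_setOf_eval_lt isSemialgebraic_setOf_eval_le)

/-- The derivative of the blow-up `ψ (s, v) = s v` in the fibre direction is `s`. [folklore] -/
theorem frullani_blowup_fderiv_mul (z : Fin (1 + 1) → ℝ) :
    fderiv ℝ (fun w : Fin (1 + 1) → ℝ => w 0 * w (Fin.last 1)) z (Pi.single (Fin.last 1) 1) = z 0 := by
  rw [((hasFDerivAt_apply (𝕜 := ℝ) (0 : Fin (1 + 1)) z).fun_mul
    (hasFDerivAt_apply (𝕜 := ℝ) (Fin.last 1) z)).fderiv]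
  simp

/-- The blow-up `(s, v) ↦ (s, s v)` evaluated on a fibre point `snoc y t`: `ψ (y, t) = y 0 · t`.
[folklore] -/
theorem frullani_blowup_snoc (y : Fin 1 → ℝ) (t : ℝ) :
    (Fin.snoc y t : Fin (1 + 1) → ℝ) 0 * (Fin.snoc y t : Fin (1 + 1) → ℝ) (Fin.last 1) = y 0 * t := by
  have h0 : (0 : Fin (1 + 1)) = Fin.castSucc (0 : Fin 1) := rfl
  rw [Fin.snoc_last, h0, Fin.snoc_castSucc]

/-- **Stub E (the fibred blow-up `t = s v` captures the escaping mass).** For the family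
`K = ({s ≤ t ≤ 2 s}, 1/(t(1+t)))` over the base `{0 < s, 2 s < 1}` there is a family `D` on the
constant band `{1 ≤ v ≤ 2}` with `D.integrand (s, v) = 1/(v (1 + s v))` on its domain and
`[D] − [K] ∈ KZ.fibredRelations`: the pull-back of `K` along the fibrewise substitution
`(s, v) ↦ (s, s v)` (Jacobian `s > 0`, strictly increasing in `v`, fixing `s`).
[Kontsevich–Zagier 2001, §1.2 rule (2)] [folklore] -/
theorem frullani_blowup :
    ∀ (K : KZ.IntegralRep (1 + 1)), K.domain = KZlog.band {y : Fin 1 → ℝ | 0 < y 0 ∧ 2 * y 0 < 1} (fun y => y 0) (fun y => 2 * y 0) → (K.integrand = fun z => (z 1 * (1 + z 1))⁻¹) → ∃ D : KZ.IntegralRep (1 + 1), D.domain = KZlog.band {y : Fin 1 → ℝ | 0 < y 0 ∧ 2 * y 0 < 1} (fun _ => 1) (fun _ => 2) ∧ (∀ z ∈ D.domain, D.integrand z = (z 1 * (1 + z 0 * z 1))⁻¹) ∧ KZ.of D - KZ.of K ∈ KZ.fibredRelations := by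
  intro K hKd hKi
  -- the base and the constant edges of the source band `{1 ≤ v ≤ 2}`
  have hG : IsSemialgebraic ℚ {y : Fin 1 → ℝ | 0 < y 0 ∧ 2 * y 0 < 1} :=
    frullani_dilation_isSemialgebraic_base
  have ha : IsSemialgebraicFunOn ℚ {y : Fin 1 → ℝ | 0 < y 0 ∧ 2 * y 0 < 1} (fun _ => (1 : ℝ)) :=
    (isSemialgebraicFunOn_aeval hG 1).congr fun y _ => by simp
  have hb : IsSemialgebraicFunOn ℚ {y : Fin 1 → ℝ | 0 < y 0 ∧ 2 * y 0 < 1} (fun _ => (2 : ℝ)) :=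
    (isSemialgebraicFunOn_aeval hG (MvPolynomial.C 2)).congr fun y _ => by simp
  have hab : ∀ y ∈ {y : Fin 1 → ℝ | 0 < y 0 ∧ 2 * y 0 < 1}, (1 : ℝ) ≤ 2 := fun _ _ => one_le_two
  have hBsa : IsSemialgebraic ℚ
      (KZlog.band {y : Fin 1 → ℝ | 0 < y 0 ∧ 2 * y 0 < 1} (fun _ => (1 : ℝ)) (fun _ => 2)) :=
    KZlog.isSemialgebraic_band ha hb
  -- the substitution `ψ (s, v) = s v`
  have hψsa : IsSemialgebraicFunOn ℚ
      (KZlog.band {y : Fin 1 → ℝ | 0 < y 0 ∧ 2 * y 0 < 1} (fun _ => (1 : ℝ)) (fun _ => 2))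
      (fun w : Fin (1 + 1) → ℝ => w 0 * w (Fin.last 1)) :=
    (isSemialgebraicFunOn_aeval hBsa (MvPolynomial.X 0 * MvPolynomial.X (Fin.last 1))).congr
      fun z _ => by simp
  have hψd : DifferentiableOn ℝ (fun w : Fin (1 + 1) → ℝ => w 0 * w (Fin.last 1)) univ :=
    ((differentiable_apply (𝕜 := ℝ) (0 : Fin (1 + 1))).fun_mul
      (differentiable_apply (𝕜 := ℝ) (Fin.last 1))).differentiableOn
  have hψ'sa : IsSemialgebraicFunOn ℚ
      (KZlog.band {y : Fin 1 → ℝ | 0 < y 0 ∧ 2 * y 0 < 1} (fun _ => (1 : ℝ)) (fun _ => 2))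
      (fun z => fderiv ℝ (fun w : Fin (1 + 1) → ℝ => w 0 * w (Fin.last 1)) z
        (Pi.single (Fin.last 1) 1)) :=
    (isSemialgebraicFunOn_aeval hBsa (MvPolynomial.X 0)).congr fun z _ => by
      rw [frullani_blowup_fderiv_mul]; simp
  have hψpos : ∀ z ∈ KZlog.band {y : Fin 1 → ℝ | 0 < y 0 ∧ 2 * y 0 < 1} (fun _ => (1 : ℝ)) (fun _ => 2),
      0 < fderiv ℝ (fun w : Fin (1 + 1) → ℝ => w 0 * w (Fin.last 1)) z (Pi.single (Fin.last 1) 1) := by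
    intro z hz
    rw [frullani_blowup_fderiv_mul]
    exact (KZlog.mem_band.1 hz).1.1
  have hψmono : ∀ y ∈ {y : Fin 1 → ℝ | 0 < y 0 ∧ 2 * y 0 < 1},
      StrictMonoOn (fun t : ℝ => (Fin.snoc y t : Fin (1 + 1) → ℝ) 0 *
        (Fin.snoc y t : Fin (1 + 1) → ℝ) (Fin.last 1)) (Icc 1 2) := by
    intro y hy t₁ _ t₂ _ ht
    simp only [frullani_blowup_snoc]
    exact mul_lt_mul_of_pos_left ht hy.1
  -- the image band `{s · 1 ≤ t ≤ s · 2}` is the band `{s ≤ t ≤ 2 s}` of `K`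
  have hKd' : K.domain = KZlog.band {y : Fin 1 → ℝ | 0 < y 0 ∧ 2 * y 0 < 1}
      (fun y => (Fin.snoc y (1 : ℝ) : Fin (1 + 1) → ℝ) 0 * (Fin.snoc y (1 : ℝ) : Fin (1 + 1) → ℝ) (Fin.last 1))
      (fun y => (Fin.snoc y (2 : ℝ) : Fin (1 + 1) → ℝ) 0 * (Fin.snoc y (2 : ℝ) : Fin (1 + 1) → ℝ) (Fin.last 1)) := by
    rw [hKd]
    simp only [frullani_blowup_snoc, mul_one, mul_comm _ (2 : ℝ)]
  -- pull `K` back along the blow-up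
  obtain ⟨D, hDd, hDi, hrel⟩ := exists_fibreSubst_pullback ha hb hab isOpen_univ (subset_univ _)
    hψsa hψd hψ'sa hψpos hψmono K hKd'
  refine ⟨D, hDd, fun z hz => ?_, hrel⟩
  -- the pulled-back integrand: `1/((s v)(1 + s v)) · s = 1/(v (1 + s v))` (`s > 0`, `v ≥ 1`)
  rw [hDd] at hz
  obtain ⟨hy, hz1, -⟩ := KZlog.mem_band.1 hz
  have hs : 0 < z 0 := hy.1
  have hv : (1 : ℝ) ≤ z 1 := hz1
  have hs' : z 0 ≠ 0 := hs.ne'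
  have hv' : z 1 ≠ 0 := (one_pos.trans_le hv).ne'
  have hsv : 1 + z 0 * z 1 ≠ 0 := by positivity
  rw [hDi]
  show K.integrand (Fin.snoc (Fin.init z) (z 0 * z (Fin.last 1))) *
      fderiv ℝ (fun w : Fin (1 + 1) → ℝ => w 0 * w (Fin.last 1)) z (Pi.single (Fin.last 1) 1) =
    (z (Fin.last 1) * (1 + z 0 * z (Fin.last 1)))⁻¹
  rw [frullani_blowup_fderiv_mul, hKi]
  show ((Fin.snoc (Fin.init z) (z 0 * z (Fin.last 1)) : Fin (1 + 1) → ℝ) (Fin.last 1) *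
      (1 + (Fin.snoc (Fin.init z) (z 0 * z (Fin.last 1)) : Fin (1 + 1) → ℝ) (Fin.last 1)))⁻¹ * z 0 =
    (z (Fin.last 1) * (1 + z 0 * z (Fin.last 1)))⁻¹
  rw [Fin.snoc_last]
  field_simp

end Summit.KontsevichZagierPeriods.ValuedFieldSpecialisation
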